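import Mathlib.MeasureTheory.Integral.IntervalIntegral.Basic
import Mathlib.Analysis.Calculus.Deriv.Basic
import Mathlib.Analysis.Calculus.ContDiff.Defs
import Mathlib.Topology.Algebra.Polynomial
import Summits.NavierStokesRegularity.TurbBounds.ShearCutoff
import HarnessLib

/-!
# The FW16 per-mode spectral form of the 2-D stress-driven shear layer at FUNCTION level: forms, admissible class,
# the NAMED REDUCTION HYPOTHESIS, and three steps proved in full (rational relaxation, wavenumber cutoff, cover)
(cell `pub-turb` / `turb-bounds`, shear lane; v2 staging — the function-level FRAME into which the kernel-checked algebraic chain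
of the shear certificates (`Certs/S50`, `Certs/S1000`: evaluators, `TailSlack`, `CutoffFree`; staged `ShearModeAssembly`,
`ShearBridgeNorms`, `Certs/<Row>/ModeForm<m>`) plugs. Files of record: `code/rbsdp/SPEC.md` §2.1–2.2, 2.9; `CERT-SHEAR.md` §1–§2;
source text Fantuzzi–Wynn, Phys. Rev. E 93 (2016) 043308 = arXiv:1512.05615 (held, `paper:arxiv-1512.05615` p0004–p0007), §2.2–2.3 and
§4 eqs. (2.8)–(2.18), (4.1)–(4.10), citing Hagstrom–Doering, J. Nonlinear Sci. 24 (2014). Written by pub-turb-shear gen 7, 2026-08-22.)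

HONEST FRAMING: rigorous bounds for the stated PDE and boundary conditions; no claim about physical turbulence beyond the bound.
This file contains NO Navier–Stokes theory. It fixes, as real-analysis objects over Mathlib (variable `ζ ∈ [−1, 1]`, a complex Fourier
amplitude written as a REAL PAIR `W = U + iV`, so that `|W″|² = U″² + V″²`, `Im(W′·W̄) = V′U − U′V`):

* `fw16Integrand α φ′ U V`, `fw16Form` — FW16 (4.1): `Q_m{W} = ∫_{−1}^{1} (16/α²)|W″|² + 8|W′|² + α²|W|² − (8/α)·φ′·Im(W′W̄) dζ`
  (`α = α_m = 2πm/Γx`; `φ′ = dφ/dζ` the background profile's derivative, a total function `ℝ → ℝ`; `deriv` = Mathlib's derivative);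
* `shearIntegrand A C D φ′ U V`, `shearForm` — rbsdp SPEC 2.2's RELAXED form `G_m{W} = A‖W″‖² + 8‖W′‖² + C‖W‖² − D·X(W)` with
  rational-able constants `A ≤ 16/α²`, `C ≤ α²`, `D ≥ 8/α` (the object the certificates are about);
* `ShearAdmissible U V` — the test class of the certificates (SPEC 2.8): `U, V ∈ C²(ℝ)`, `W(±1) = 0`, `W′(−1) = 0`
  (FW16 (4.2) imposes in addition the natural condition `W″(1) = 0`; dropping it enlarges the class, see `FW16Reduction`);
* `FW16Positivity Γx φ′` — `Q_m{W} ≥ 0` for EVERY `m ≥ 1` and every admissible pair;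
* `boundValue Gr φ′ = 2·∫_{−1}^{1}φ′ − (2/Gr)·∫_{−1}^{1}φ′²` — the value `−𝓑{φ}` of FW16 (2.12)/(2.16) with `φ(−1) = 0` (so `φ(1) = ∫φ′`);
* `FW16Reduction Γx Gr ū` — the NAMED HYPOTHESIS (harness model, as `LayerForm.LayerReduction`: a published theorem USED, never proved
  here; exact transcription + sources in its docstring): for a polynomial profile derivative `φ′` with `φ′(1) = Gr/2`, `FW16Positivity`
  implies `boundValue Gr φ′ ≤ ū`, `ū` = the mean surface velocity `⟨u⟩‾(1)` of a solution (so `C_ε = Gr/ū²`, FW16 (2.9));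
and PROVES: `shearForm_eq` / `fw16Form_eq` (the forms as combinations of the four integrals `‖W″‖², ‖W′‖², ‖W‖², X`);
`fw16Form_nonneg_of_shearForm` (SPEC 2.2 at the integral level, from the tree's `ShearReductions.fw16_rational_relaxation`) and its cell
versions `fw16Form_nonneg_of_shearForm_cell` / `_mode` (the cell's constants `Acell/Ccell/Dcell` = `4Γx²/(π_hi²m²)`, `4π_lo²m²/Γx²`, `4Γx/(π_lo m)` via `ShearCutoff.Am_le/Cm_le/Dm_ge`);
`fw16Integrand_nonneg_of_cutoff` / `fw16Form_nonneg_of_cutoff` (SPEC 2.9 = FW16 (2.17)–(2.18) for the single-amplitude form: `|φ′| ≤ T`,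
`2T ≤ α²` ⇒ the integrand is POINTWISE `≥ 0`, hence `Q_m ≥ 0` for ALL `U, V`, no regularity needed); `fw16Positivity_of_cover` (certified
modes `m ≤ m_cert` + the certificates' scalar cutoff line `Γx²T ≤ 2π²(m_cert+1)²` through `ShearCutoff.modes_free_nat` ⇒ all `m ≥ 1`);
`boundValue_le_laminar` / `fw16Reduction_laminar` (vacuity guard: `boundValue ≤ Gr` for EVERY profile, so the hypothesis holds for the
laminar value `ū = Gr` and is satisfiable as typed); `ceps_le_of_lower_bound` (the row shape: `0 < B ≤ ū ⇒ Gr/ū² ≤ Gr/B²`).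
NOT HERE: the identification of `shearForm` on polynomial pairs with the certificates' quadratic forms (staged `ShearBridgeNorms` +
the cross-term split, v2 items V2-BRIDGE/V2-TAIL), density (`ShearDensity`), and any formalisation of the fluid equations.
-/

set_option linter.style.longLine false

noncomputable section

namespace Summit.NavierStokesRegularity.TurbBounds.ShearForm

open MeasureTheory intervalIntegral Set

/-! ## 1. The forms -/

/-- Integrand of FW16's per-mode spectral form (4.1) at wavenumber `α > 0` for the amplitude `W = U + iV`:
`(16/α²)(U″² + V″²) + 8(U′² + V′²) + α²(U² + V²) − (8/α)·φ′·(V′U − U′V)` at the point `x` (`V′U − U′V = Im(W′W̄)`). -/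
def fw16Integrand (α : ℝ) (φp : ℝ → ℝ) (U V : ℝ → ℝ) (x : ℝ) : ℝ :=
  16 / α ^ 2 * ((deriv (deriv U) x) ^ 2 + (deriv (deriv V) x) ^ 2) + 8 * ((deriv U x) ^ 2 + (deriv V x) ^ 2)
    + α ^ 2 * ((U x) ^ 2 + (V x) ^ 2) - 8 / α * (φp x * (deriv V x * U x - deriv U x * V x))

/-- FW16's per-mode spectral form `Q_m{W} = ∫_{−1}^{1} fw16Integrand` (interval integral, Lebesgue measure). -/
def fw16Form (α : ℝ) (φp : ℝ → ℝ) (U V : ℝ → ℝ) : ℝ :=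
  ∫ x in (-1 : ℝ)..1, fw16Integrand α φp U V x

/-- Integrand of the RELAXED form of rbsdp SPEC 2.2 with constants `A, C, D`:
`A(U″² + V″²) + 8(U′² + V′²) + C(U² + V²) − D·φ′·(V′U − U′V)`. -/
def shearIntegrand (A C D : ℝ) (φp : ℝ → ℝ) (U V : ℝ → ℝ) (x : ℝ) : ℝ :=
  A * ((deriv (deriv U) x) ^ 2 + (deriv (deriv V) x) ^ 2) + 8 * ((deriv U x) ^ 2 + (deriv V x) ^ 2)
    + C * ((U x) ^ 2 + (V x) ^ 2) - D * (φp x * (deriv V x * U x - deriv U x * V x))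

/-- The relaxed form `G_m{W} = ∫_{−1}^{1} shearIntegrand` (SPEC 2.2: `A‖W″‖² + 8‖W′‖² + C‖W‖² − D·X(W)`, `X(W) = ∫φ′·Im(W′W̄)`). -/
def shearForm (A C D : ℝ) (φp : ℝ → ℝ) (U V : ℝ → ℝ) : ℝ :=
  ∫ x in (-1 : ℝ)..1, shearIntegrand A C D φp U V x

/-- The admissible test class of the shear certificates (rbsdp SPEC 2.8; FW16 (4.2) without the natural condition `W″(1) = 0`):
both components twice continuously differentiable, no-slip bottom `W(−1) = W′(−1) = 0`, impermeable top `W(1) = 0`. -/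
structure ShearAdmissible (U V : ℝ → ℝ) : Prop where
  /-- `U = Re W` is `C²`. -/
  hU : ContDiff ℝ 2 U
  /-- `V = Im W` is `C²`. -/
  hV : ContDiff ℝ 2 V
  /-- bottom wall `ζ = −1`: `U(−1) = 0`. -/
  U_bot : U (-1) = 0
  /-- bottom wall: `U′(−1) = 0`. -/
  dU_bot : deriv U (-1) = 0
  /-- top `ζ = 1`: `U(1) = 0`. -/
  U_top : U 1 = 0
  /-- bottom wall: `V(−1) = 0`. -/
  V_bot : V (-1) = 0
  /-- bottom wall: `V′(−1) = 0`. -/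
  dV_bot : deriv V (-1) = 0
  /-- top: `V(1) = 0`. -/
  V_top : V 1 = 0

/-- The class is inhabited (the zero pair). -/
theorem shearAdmissible_zero : ShearAdmissible (fun _ => 0) (fun _ => 0) where
  hU := contDiff_const
  hV := contDiff_const
  U_bot := rfl
  dU_bot := by simp
  U_top := rfl
  V_bot := rfl
  dV_bot := by simp
  V_top := rfl

/-- `Q_m{W} ≥ 0` for EVERY 2-D mode `m ≥ 1` (`α_m = 2πm/Γx`) and every admissible pair — the spectral constraint of FW16 (4.4) for the
profile derivative `φ′` in the period-`Γx` layer (all `m ≥ 1`, not only `m ≤ m_c(φ)`: the cutoff is proved below, not assumed). -/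
def FW16Positivity (Γx : ℝ) (φp : ℝ → ℝ) : Prop :=
  ∀ m : ℕ, 1 ≤ m → ∀ U V : ℝ → ℝ, ShearAdmissible U V → 0 ≤ fw16Form (2 * Real.pi * (m : ℝ) / Γx) φp U V

/-- The value `−𝓑{φ} = 2φ(1) − (2/Gr)∫_{−1}^{1} φ′²` of FW16 (2.16) for a profile with `φ(−1) = 0`, written with `φ(1) = ∫_{−1}^{1} φ′`. -/
def boundValue (Gr : ℝ) (φp : ℝ → ℝ) : ℝ :=
  2 * (∫ x in (-1 : ℝ)..1, φp x) - 2 / Gr * ∫ x in (-1 : ℝ)..1, (φp x) ^ 2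

/-! ## 2. The named reduction hypothesis (CITED; used as a hypothesis, never proved in this cell) -/

/-- **Named hypothesis `FW16Reduction Γx Gr ū`** (harness model, like `LayerForm.LayerReduction`). TRANSCRIPTION for the referee: for the
2-D layer of period `Γx > 0` driven by the surface stress `Gr > 0` — FW16 §2.1 in the variables `ζ = 2z − 1`: no-slip bottom `u = 0` at
`ζ = −1`, `∂u/∂z = Gr`, `w = 0` at `ζ = 1` — and every background profile `φ(ζ)` with `φ(−1) = 0` whose derivative `φ′` is a POLYNOMIAL with
`φ′(1) = Gr/2` (FW16 (4.4)–(4.6); Hagstrom–Doering allow general profiles — restricting to polynomial ones, as FW16 §4.1 does, only weakens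
the hypothesis): IF the per-mode spectral constraints `Q_m{W} ≥ 0` (FW16 (4.1)) hold for every `m ≥ 1` and every admissible amplitude,
THEN the long-time mean surface velocity obeys `⟨u⟩‾(1) ≥ −𝓑{φ} = 2φ(1) − (2/Gr)∫_{−1}^{1}φ′²` (FW16 (2.12) rescaled as (2.16)).
[cite: FantuzziWynn2015, §2.2 (2.10)–(2.12), §2.3 (2.13)–(2.16), §4 (4.1)–(4.4)], the bounding principle being Hagstrom–Doering's
[cite: HagstromDoering2013, §4: `ū(1) = 2U(1) − (1/Gr)⟨(dU/dz)²⟩ + (2/Gr)·Q_U`, hence `ū(1) ≥ 2U(1) − (1/Gr)⟨(dU/dz)²⟩` whenever `Q_U ≥ 0`]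
(held texts `paper:arxiv-1512.05615` p0004–p0007, `paper:arxiv-1305.3890` p0007). CLASS: FW16's admissible amplitudes are the `H²` functions with `W(±1) = W′(−1) = W″(1) = 0`
(their (4.2)); here the antecedent quantifies over `ShearAdmissible` = `C²` pairs with `W(±1) = W′(−1) = 0` — a LARGER set of test
functions up to density (the `C²` functions with these three conditions are `H²`-dense in the `H²` ones, and `Q_m` is `H²`-continuous,
refereed density remark as for `LayerReduction`), so the antecedent here implies FW16's and the hypothesis as typed is implied by the
published theorem. MEANING OF `ū`: any real number equal to the long-time, horizontally averaged surface velocity `⟨u⟩‾(1)` of SOME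
(Leray–Hopf) solution of the stated 2-D problem at `(Γx, Gr)`; its dissipation coefficient is `C_ε = Gr/ū²` (FW16 (2.9), from the identity
`⟨|∇u|²⟩ = Gr·⟨u⟩‾(1)`). A row theorem `∀ ū, FW16Reduction Γx Gr ū → … → U ≤ ū ∧ Gr/ū² ≤ C` is thus the bound for all solutions.
VACUITY: satisfiable as typed — it holds for the laminar value `ū = Gr` with NO assumption (`fw16Reduction_laminar`); that it is not
provable for every `ū` is shown per row from the certificate (`Results.<Row>.fw16Reduction_nontrivial`). -/
def FW16Reduction (Γx Gr ubar : ℝ) : Prop :=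
  ∀ q : Polynomial ℝ, q.eval 1 = Gr / 2 → FW16Positivity Γx (fun x => q.eval x) →
    boundValue Gr (fun x => q.eval x) ≤ ubar

/-! ## 3. The forms as combinations of four integrals -/

/-- Linearity bookkeeping: `∫ (a·f₁ + b·f₂ + c·f₃ − d·f₄) = a∫f₁ + b∫f₂ + c∫f₃ − d∫f₄` on `[−1, 1]` for continuous `fᵢ`. -/
theorem integral_comb4 {f₁ f₂ f₃ f₄ : ℝ → ℝ} (h₁ : Continuous f₁) (h₂ : Continuous f₂) (h₃ : Continuous f₃)
    (h₄ : Continuous f₄) (a b c d : ℝ) :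
    ∫ x in (-1 : ℝ)..1, (a * f₁ x + b * f₂ x + c * f₃ x - d * f₄ x)
      = a * (∫ x in (-1 : ℝ)..1, f₁ x) + b * (∫ x in (-1 : ℝ)..1, f₂ x) + c * (∫ x in (-1 : ℝ)..1, f₃ x)
        - d * ∫ x in (-1 : ℝ)..1, f₄ x := by
  have i₁ : IntervalIntegrable (fun x => a * f₁ x) volume (-1 : ℝ) 1 := (continuous_const.mul h₁).intervalIntegrable _ _
  have i₂ : IntervalIntegrable (fun x => b * f₂ x) volume (-1 : ℝ) 1 := (continuous_const.mul h₂).intervalIntegrable _ _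
  have i₃ : IntervalIntegrable (fun x => c * f₃ x) volume (-1 : ℝ) 1 := (continuous_const.mul h₃).intervalIntegrable _ _
  have i₄ : IntervalIntegrable (fun x => d * f₄ x) volume (-1 : ℝ) 1 := (continuous_const.mul h₄).intervalIntegrable _ _
  rw [intervalIntegral.integral_sub ((i₁.add i₂).add i₃) i₄, intervalIntegral.integral_add (i₁.add i₂) i₃,
    intervalIntegral.integral_add i₁ i₂]
  simp only [intervalIntegral.integral_const_mul]

/-- Regularity facts of a `C²` function used throughout: `U, U′, U″` are continuous. -/
theorem contDiff_two_continuous {U : ℝ → ℝ} (hU : ContDiff ℝ 2 U) :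
    Continuous U ∧ Continuous (deriv U) ∧ Continuous (deriv (deriv U)) := by
  refine ⟨hU.continuous, hU.continuous_deriv (by norm_num), ?_⟩
  have h := hU.continuous_iteratedDeriv 2 (by norm_num)
  rwa [iteratedDeriv_succ, iteratedDeriv_one] at h

/-- **The relaxed form as a combination of the four integrals** `p = ‖W″‖²`, `q = ‖W′‖²`, `r = ‖W‖²`, `X = ∫φ′·Im(W′W̄)`:
`shearForm A C D φ′ U V = A·p + 8·q + C·r − D·X` (continuous data). -/
theorem shearForm_eq (A C D : ℝ) {φp U V : ℝ → ℝ} (hφ : Continuous φp) (hU : ContDiff ℝ 2 U) (hV : ContDiff ℝ 2 V) :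
    shearForm A C D φp U V
      = A * (∫ x in (-1 : ℝ)..1, ((deriv (deriv U) x) ^ 2 + (deriv (deriv V) x) ^ 2))
        + 8 * (∫ x in (-1 : ℝ)..1, ((deriv U x) ^ 2 + (deriv V x) ^ 2))
        + C * (∫ x in (-1 : ℝ)..1, ((U x) ^ 2 + (V x) ^ 2))
        - D * ∫ x in (-1 : ℝ)..1, φp x * (deriv V x * U x - deriv U x * V x) := by
  obtain ⟨hU0, hU1, hU2⟩ := contDiff_two_continuous hU
  obtain ⟨hV0, hV1, hV2⟩ := contDiff_two_continuous hV
  unfold shearForm shearIntegrand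
  exact integral_comb4 (by fun_prop) (by fun_prop) (by fun_prop) (by fun_prop) A 8 C D

/-- **FW16's form as a combination of the same four integrals**: `fw16Form α φ′ U V = (16/α²)·p + 8·q + α²·r − (8/α)·X`. -/
theorem fw16Form_eq (α : ℝ) {φp U V : ℝ → ℝ} (hφ : Continuous φp) (hU : ContDiff ℝ 2 U) (hV : ContDiff ℝ 2 V) :
    fw16Form α φp U V
      = 16 / α ^ 2 * (∫ x in (-1 : ℝ)..1, ((deriv (deriv U) x) ^ 2 + (deriv (deriv V) x) ^ 2))
        + 8 * (∫ x in (-1 : ℝ)..1, ((deriv U x) ^ 2 + (deriv V x) ^ 2))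
        + α ^ 2 * (∫ x in (-1 : ℝ)..1, ((U x) ^ 2 + (V x) ^ 2))
        - 8 / α * ∫ x in (-1 : ℝ)..1, φp x * (deriv V x * U x - deriv U x * V x) := by
  obtain ⟨hU0, hU1, hU2⟩ := contDiff_two_continuous hU
  obtain ⟨hV0, hV1, hV2⟩ := contDiff_two_continuous hV
  unfold fw16Form fw16Integrand
  exact integral_comb4 (by fun_prop) (by fun_prop) (by fun_prop) (by fun_prop) (16 / α ^ 2) 8 (α ^ 2) (8 / α)

/-! ## 4. rbsdp SPEC 2.2 at the integral level: the relaxed form controls FW16's form -/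

/-- **SPEC 2.2 (rational relaxation), function level.** If `α > 0`, `A ≤ 16/α²`, `C ≤ α²`, `8/α ≤ D` and the relaxed form of the `C²` pair
`(U, V)` is `≥ 0`, then FW16's form of the same pair is `≥ 0` (the tree's scalar core `fw16_rational_relaxation` applied to the four
integrals; the three norms are `≥ 0` as integrals of squares). -/
theorem fw16Form_nonneg_of_shearForm {α A C D : ℝ} {φp U V : ℝ → ℝ} (hα : 0 < α) (hA : A ≤ 16 / α ^ 2) (hC : C ≤ α ^ 2)
    (hD : 8 / α ≤ D) (hφ : Continuous φp) (hU : ContDiff ℝ 2 U) (hV : ContDiff ℝ 2 V)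
    (h : 0 ≤ shearForm A C D φp U V) : 0 ≤ fw16Form α φp U V := by
  rw [shearForm_eq A C D hφ hU hV] at h
  rw [fw16Form_eq α hφ hU hV]
  have hp : 0 ≤ ∫ x in (-1 : ℝ)..1, ((deriv (deriv U) x) ^ 2 + (deriv (deriv V) x) ^ 2) :=
    intervalIntegral.integral_nonneg (by norm_num) fun x _ => by positivity
  have hq : 0 ≤ ∫ x in (-1 : ℝ)..1, ((deriv U x) ^ 2 + (deriv V x) ^ 2) :=
    intervalIntegral.integral_nonneg (by norm_num) fun x _ => by positivity
  have hr : 0 ≤ ∫ x in (-1 : ℝ)..1, ((U x) ^ 2 + (V x) ^ 2) :=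
    intervalIntegral.integral_nonneg (by norm_num) fun x _ => by positivity
  exact fw16_rational_relaxation hα hA hC hD hp hq hr h

/-- **SPEC 2.2 with the cell's constants** (`A_m = 4Γx²/(π_hi²m²)`, `C_m = 4π_lo²m²/Γx²`, `D_m = 4Γx/(π_lo m)`, `π_lo = 4272943/1360120`,
`π_hi = 5419351/1725033`; `ShearCutoff.Am_le/Cm_le/Dm_ge`): the relaxed form `≥ 0` for a `C²` pair implies `Q_m ≥ 0` at `α_m = 2πm/Γx`. -/
theorem fw16Form_nonneg_of_shearForm_cell {Gx m : ℝ} {φp U V : ℝ → ℝ} (hGx : 0 < Gx) (hm : 0 < m) (hφ : Continuous φp)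
    (hU : ContDiff ℝ 2 U) (hV : ContDiff ℝ 2 V)
    (h : 0 ≤ shearForm (4 * Gx ^ 2 / (((5419351 : ℝ) / 1725033) ^ 2 * m ^ 2)) (4 * ((4272943 : ℝ) / 1360120) ^ 2 * m ^ 2 / Gx ^ 2)
      (4 * Gx / (((4272943 : ℝ) / 1360120) * m)) φp U V) :
    0 ≤ fw16Form (2 * Real.pi * m / Gx) φp U V := by
  have hα : 0 < 2 * Real.pi * m / Gx := by positivity
  have hlo : (0 : ℝ) < (4272943 : ℝ) / 1360120 := by norm_num
  exact fw16Form_nonneg_of_shearForm hα (ShearCutoff.Am_le hGx hm ShearCutoff.pi_lt_piHi.le)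
    (ShearCutoff.Cm_le hGx hlo.le ShearCutoff.piLo_lt_pi.le) (ShearCutoff.Dm_ge hGx hm hlo ShearCutoff.piLo_lt_pi.le) hφ hU hV h

/-- The cell's rational constant `A_m(Γx) = 4Γx²/(π_hi² m²)` (`≤ 16/α_m²`; rbsdp SPEC 2.2, `π_hi = 5419351/1725033`) as a real number. -/
def Acell (Gx : ℝ) (m : ℕ) : ℝ := 4 * Gx ^ 2 / (((5419351 : ℝ) / 1725033) ^ 2 * (m : ℝ) ^ 2)

/-- The cell's rational constant `C_m(Γx) = 4π_lo² m²/Γx²` (`≤ α_m²`; `π_lo = 4272943/1360120`). -/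
def Ccell (Gx : ℝ) (m : ℕ) : ℝ := 4 * ((4272943 : ℝ) / 1360120) ^ 2 * (m : ℝ) ^ 2 / Gx ^ 2

/-- The cell's rational constant `D_m(Γx) = 4Γx/(π_lo m)` (`≥ 8/α_m`). -/
def Dcell (Gx : ℝ) (m : ℕ) : ℝ := 4 * Gx / (((4272943 : ℝ) / 1360120) * (m : ℝ))

/-- **SPEC 2.2 with the cell's constants, mode index `m ≥ 1`**: `shearForm (A_m) (C_m) (D_m) ≥ 0` for a `C²` pair implies `Q_m ≥ 0` at `α_m = 2πm/Γx`. -/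
theorem fw16Form_nonneg_of_shearForm_mode {Gx : ℝ} {m : ℕ} {φp U V : ℝ → ℝ} (hGx : 0 < Gx) (hm : 1 ≤ m) (hφ : Continuous φp)
    (hU : ContDiff ℝ 2 U) (hV : ContDiff ℝ 2 V) (h : 0 ≤ shearForm (Acell Gx m) (Ccell Gx m) (Dcell Gx m) φp U V) :
    0 ≤ fw16Form (2 * Real.pi * (m : ℝ) / Gx) φp U V := by
  have hm0 : (0 : ℝ) < (m : ℝ) := by exact_mod_cast hm
  unfold Acell Ccell Dcell at h
  exact fw16Form_nonneg_of_shearForm_cell hGx hm0 hφ hU hV h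

/-! ## 5. rbsdp SPEC 2.9 = FW16 (2.17)–(2.18) for the single-amplitude form: modes beyond the cutoff are free -/

/-- Scalar core of the cutoff for the single-amplitude form: if `k² ≤ 16α²` then `4d² + α²e² − k·d·e ≥ 0`
(`16·(4d² + α²e² − kde) = (8d − ke)² + (16α² − k²)e²`). -/
theorem quad_de_nonneg {k α d e : ℝ} (hk : k ^ 2 ≤ 16 * α ^ 2) : 0 ≤ 4 * d ^ 2 + α ^ 2 * e ^ 2 - k * d * e := by
  nlinarith [sq_nonneg (8 * d - k * e), mul_nonneg (sub_nonneg.mpr hk) (sq_nonneg e)]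

/-- **Cutoff, pointwise.** If `α > 0`, `|φ′(x)| ≤ T` and `2T ≤ α²` then FW16's integrand at `x` is `≥ 0` for ALL values of
`U, U′, U″, V, V′, V″` there: `|(8/α)φ′(V′U − U′V)| ≤ 4(U′² + V′²) + α²(U² + V²)` because `(8φ′/α)² ≤ 16α²`. -/
theorem fw16Integrand_nonneg_of_cutoff {α T : ℝ} {φp : ℝ → ℝ} (hα : 0 < α) (hcut : 2 * T ≤ α ^ 2) {x : ℝ}
    (hφ : |φp x| ≤ T) (U V : ℝ → ℝ) : 0 ≤ fw16Integrand α φp U V x := by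
  have hT : 0 ≤ T := le_trans (abs_nonneg _) hφ
  have hg2 : (φp x) ^ 2 ≤ T ^ 2 := by
    have h1 := abs_le.mp hφ
    nlinarith [h1.1, h1.2]
  have hT4 : 4 * T ^ 2 ≤ α ^ 4 := by nlinarith [hcut, hT]
  have hα2 : 0 < α ^ 2 := by positivity
  -- the coupling coefficient k = 8φ′/α obeys k² ≤ 16α²
  have hk : (8 * φp x / α) ^ 2 ≤ 16 * α ^ 2 := by
    rw [div_pow, div_le_iff₀ hα2]
    have : (8 * φp x) ^ 2 = 64 * (φp x) ^ 2 := by ring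
    rw [this]
    have h16 : 16 * α ^ 2 * α ^ 2 = 16 * α ^ 4 := by ring
    rw [h16]
    nlinarith [hg2, hT4]
  have hk' : (-(8 * φp x / α)) ^ 2 ≤ 16 * α ^ 2 := by rw [neg_sq]; exact hk
  have h1 := quad_de_nonneg (d := deriv V x) (e := U x) hk
  have h2 := quad_de_nonneg (d := deriv U x) (e := V x) hk'
  have h3 : 0 ≤ 16 / α ^ 2 * ((deriv (deriv U) x) ^ 2 + (deriv (deriv V) x) ^ 2) := by positivity
  have h4 : 0 ≤ 4 * (deriv U x) ^ 2 + 4 * (deriv V x) ^ 2 := by positivity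
  have e : fw16Integrand α φp U V x
      = 16 / α ^ 2 * ((deriv (deriv U) x) ^ 2 + (deriv (deriv V) x) ^ 2)
        + (4 * (deriv U x) ^ 2 + 4 * (deriv V x) ^ 2)
        + (4 * (deriv V x) ^ 2 + α ^ 2 * (U x) ^ 2 - (8 * φp x / α) * deriv V x * U x)
        + (4 * (deriv U x) ^ 2 + α ^ 2 * (V x) ^ 2 - (-(8 * φp x / α)) * deriv U x * V x) := by
    unfold fw16Integrand
    field_simp
    ring
  rw [e]
  exact add_nonneg (add_nonneg (add_nonneg h3 h4) h1) h2

/-- **FW16 (2.17)–(2.18) for the single-amplitude form, integrated.** If `α > 0`, `|φ′| ≤ T` on `[−1, 1]` and `2T ≤ α²` then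
`Q_m{W} ≥ 0` for ALL `U, V : ℝ → ℝ` — no regularity and no wall condition are needed (the integrand is pointwise `≥ 0` on `[−1, 1]`;
`intervalIntegral.integral_nonneg` also covers the non-integrable junk case). -/
theorem fw16Form_nonneg_of_cutoff {α T : ℝ} {φp : ℝ → ℝ} (hα : 0 < α) (hφ : ∀ x ∈ Icc (-1 : ℝ) 1, |φp x| ≤ T)
    (hcut : 2 * T ≤ α ^ 2) (U V : ℝ → ℝ) : 0 ≤ fw16Form α φp U V := by
  unfold fw16Form
  exact intervalIntegral.integral_nonneg (by norm_num) fun x hx => fw16Integrand_nonneg_of_cutoff hα hcut (hφ x hx) U V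

/-- **Cover: certified modes + the scalar cutoff line give the spectral constraint for every mode.** If `Γx > 0`, `|φ′| ≤ T` on `[−1, 1]`,
the certificates' cutoff line `Γx²·T ≤ 2π²·(m_cert + 1)²` holds (`Certs/<Row>/Scalars.cutoff`, rbsdp SPEC 2.9) and `Q_m ≥ 0` on the admissible
class for the finitely many modes `1 ≤ m ≤ m_cert`, then `FW16Positivity Γx φ′`. -/
theorem fw16Positivity_of_cover {Gx T : ℝ} {φp : ℝ → ℝ} {mCert : ℕ} (hGx : 0 < Gx)
    (hφ : ∀ x ∈ Icc (-1 : ℝ) 1, |φp x| ≤ T) (hcut : Gx ^ 2 * T ≤ 2 * Real.pi ^ 2 * ((mCert : ℝ) + 1) ^ 2)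
    (hfin : ∀ m : ℕ, 1 ≤ m → m ≤ mCert → ∀ U V : ℝ → ℝ, ShearAdmissible U V →
      0 ≤ fw16Form (2 * Real.pi * (m : ℝ) / Gx) φp U V) :
    FW16Positivity Gx φp := by
  intro m hm U V hUV
  by_cases hle : m ≤ mCert
  · exact hfin m hm hle U V hUV
  · have hge : mCert + 1 ≤ m := by omega
    have h2T := ShearCutoff.modes_free_nat hGx hcut hge
    have hm0 : (0 : ℝ) < (m : ℝ) := by exact_mod_cast (show 0 < m by omega)
    have hα : 0 < 2 * Real.pi * (m : ℝ) / Gx := by positivity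
    exact fw16Form_nonneg_of_cutoff hα hφ h2T U V

/-! ## 6. Consequences of the hypothesis and vacuity guards -/

/-- **The bound value never exceeds the laminar surface velocity**: for every continuous `φ′` and `Gr > 0`,
`2∫φ′ − (2/Gr)∫φ′² ≤ Gr` (pointwise `2φ′ − (2/Gr)φ′² ≤ Gr/2`, i.e. `(2/Gr)(φ′ − Gr/2)² ≥ 0`, integrated over `[−1, 1]`). -/
theorem boundValue_le_laminar {Gr : ℝ} (hGr : 0 < Gr) {φp : ℝ → ℝ} (hφ : Continuous φp) : boundValue Gr φp ≤ Gr := by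
  unfold boundValue
  have i₁ : IntervalIntegrable (fun x => 2 * φp x) volume (-1 : ℝ) 1 := (continuous_const.mul hφ).intervalIntegrable _ _
  have i₂ : IntervalIntegrable (fun x => 2 / Gr * (φp x) ^ 2) volume (-1 : ℝ) 1 :=
    (continuous_const.mul (hφ.pow 2)).intervalIntegrable _ _
  have hlin : 2 * (∫ x in (-1 : ℝ)..1, φp x) - 2 / Gr * (∫ x in (-1 : ℝ)..1, (φp x) ^ 2)
      = ∫ x in (-1 : ℝ)..1, (2 * φp x - 2 / Gr * (φp x) ^ 2) := by
    rw [intervalIntegral.integral_sub i₁ i₂, intervalIntegral.integral_const_mul, intervalIntegral.integral_const_mul]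
  rw [hlin]
  have hmono : (∫ x in (-1 : ℝ)..1, (2 * φp x - 2 / Gr * (φp x) ^ 2)) ≤ ∫ x in (-1 : ℝ)..1, (Gr / 2 : ℝ) := by
    refine intervalIntegral.integral_mono_on (by norm_num) (i₁.sub i₂) intervalIntegrable_const fun x _ => ?_
    have hsq : 0 ≤ 2 / Gr * (φp x - Gr / 2) ^ 2 := by positivity
    have e : 2 / Gr * (φp x - Gr / 2) ^ 2 = 2 / Gr * (φp x) ^ 2 - 2 * φp x + Gr / 2 := by
      field_simp
      ring
    linarith [hsq, e]
  have hconst : (∫ x in (-1 : ℝ)..1, (Gr / 2 : ℝ)) = Gr := by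
    rw [intervalIntegral.integral_const, smul_eq_mul]; ring
  linarith

/-- **Vacuity guard: `FW16Reduction` is satisfiable as typed.** For `Gr > 0` it holds for the laminar value `ū = Gr` (Couette flow
`u = Gr·z` has `⟨u⟩(1) = Gr`, and `C_ε ≥ 1/Gr` always [FW16 §2.2 after Tang–Caulfield–Young]) — with NO use of the antecedent. -/
theorem fw16Reduction_laminar (Γx : ℝ) {Gr : ℝ} (hGr : 0 < Gr) : FW16Reduction Γx Gr Gr := by
  intro q _ _
  exact boundValue_le_laminar hGr q.continuous

/-- Using the hypothesis (definitional unfolding, for readability of the row files): a polynomial profile derivative with `φ′(1) = Gr/2`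
whose spectral constraints all hold has `boundValue ≤ ū`. -/
theorem boundValue_le_of_reduction {Γx Gr ubar : ℝ} (hRed : FW16Reduction Γx Gr ubar) (q : Polynomial ℝ)
    (hq : q.eval 1 = Gr / 2) (hpos : FW16Positivity Γx (fun x => q.eval x)) :
    boundValue Gr (fun x => q.eval x) ≤ ubar :=
  hRed q hq hpos

/-- **The row shape.** If `0 < B ≤ ū` (a certified POSITIVE lower bound on the mean surface velocity) and `0 ≤ Gr`, then the dissipation
coefficient `C_ε = Gr/ū²` is at most `Gr/B²`. -/
theorem ceps_le_of_lower_bound {Gr B ubar : ℝ} (hGr : 0 ≤ Gr) (hB : 0 < B) (hle : B ≤ ubar) :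
    Gr / ubar ^ 2 ≤ Gr / B ^ 2 := by
  have hu : 0 < ubar := lt_of_lt_of_le hB hle
  exact div_le_div_of_nonneg_left hGr (by positivity) (pow_le_pow_left₀ hB.le hle 2)

end Summit.NavierStokesRegularity.TurbBounds.ShearForm

end
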